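import Summits.CriticalPhenomena.PercolationContinuityZ3.Theorems.FK.Transplant.KNFreeRun
import HarnessLib

/-!
# FK-continuity transplant, FT-07 (b, continued): consequences of the run invariant — (29), the cover, (31)
# (law-free port of `KozmaNitzanTheorem6.lean` ll. 296–466 with `schemeFK`)

Cell `fk-continuity` (bschramm), FRONTIER TRANSPLANT sub-cell, row FT-07 (`KNFreeTheorem6`, part b: run
invariants); support file (`--supports stmt-CriticalPhenomena-4575`); builds on p205010 (kernel theorem, internal
audit signed; external expert review pending). HONEST FRAMING: the transplant this file serves is CONDITIONAL on the
free-boundary penetration hypothesis FH (open at the same `p` for `q > 1`; ⇔ GRC Conj. (5.103) via K1; barrier note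
`Literature.Barriers.CriticalPhenomena.SamePFreeBoundaryCriteria`); a typed reduction, not a proof of FK continuity.
THIS file is law-free combinatorics of the run: no named facts, no sorries, standard axioms; `FH` does not occur.

## What is here

Consequences of the run invariant `RunFK.runInv` (`KNFreeRun.lean`) of the FK exploration process `schemeFK S q`:
`zero_mem_V`, `zero_mem_occ`, `cen_mem_V_of_det` ((29)), `newRegion_subset_V`, `det_tgt_of_probe`,
`V_subset_Cover` (the explored region lies in the cover of the determined macro-vertices), `det_of_cen_mem_V`
((29) converse), `probe_time_unique`, and (31): `newRegion_disjoint`, `mem_onward_of_not_det`,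
`mem_Stub_of_mem_V_of_mem_Efar` (after the examination of `w`, while `v = w + du` is undetermined, the explored region
meets `E_{w,v}` only inside the revealed stub `H^{j_x}_{w,v}`), `not_mem_Ewv_zero_of_mem_V`. Verbatim port of
tree `KozmaNitzanTheorem6.lean` (KN arXiv:2401.12397 §4 pp. 26–28) with the FK scheme.

## References

* G. Kozma, S. Nitzan, arXiv:2401.12397 (2024), §4 pp. 26–28 ((29), (31)). [KozmaNitzan2024]
-/

noncomputable section

open MeasureTheory
open scoped ENNReal Classical

namespace Summit.CriticalPhenomena.PercolationContinuityZ3.Theorems.FK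

open Literature.Probability.Percolation Literature.Probability.LatticeModels SimpleGraph
open Literature.Probability.Percolation.GadgetSystem Literature.Probability.Percolation.KozmaNitzan
open ProbeHistory HSiteScheme KSch Cells

variable {d : ℕ}

namespace RunFK

/-! ## Consequences of the invariant -/

section Consequences

variable {S : KSch d} {q : ℝ}
variable {ω : BondConfig (Site d)}

/-- `0 ∈ V`. [folklore] -/
theorem zero_mem_V (n : ℕ) : (0 : Site d) ∈ S.V ((hst S q) ω n) := by
  have h0 : (0 : Site d) ∈ S.V ((hst S q) ω 0) := by
    show (0 : Site d) ∈ S.V []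
    rw [KSch.V_nil S, Cells.Q, ← S.C.cen_zero]
    exact center_mem_cIcc _ _
  exact (V_mono S q) ω (Nat.zero_le n) h0

/-- The origin is always occupied. [folklore] -/
theorem zero_mem_occ (n : ℕ) : (0 : Site 2) ∈ ((schemeFK S q).stN n ω).occ :=
  ((schemeFK S q).inv_mst _).zero_mem

/-- A determined macro-vertex has its centre explored. [cite: KozmaNitzan2024, §4 p. 26 ((29))] -/
theorem cen_mem_V_of_det {n : ℕ} {x : Site 2} (hx : ((schemeFK S q).stN n ω).Det x) : S.C.cen x ∈ S.V ((hst S q) ω n) :=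
  ((runInv S q) ω n).det_Q x hx (center_mem_cIcc _ _)

/-- The new region of a probe lies in the explored region afterwards. [cite: KozmaNitzan2024, §4 p. 27 (E_{i+1})] -/
theorem newRegion_subset_V {m n : ℕ} (hmn : m < n) {e : Site 2 × MDir} (hc : ((schemeFK S q).stN m ω).choice = some e)
    (hD : (schemeFK S q).E.next ((hst S q) ω m) = some ((probeFK S q) ((hst S q) ω m) e)) :
    (newRegionFK S q) ((hst S q) ω m) e (obs ω (S.env ((hst S q) ω m) e)) ⊆ S.V ((hst S q) ω n) := by
  have h1 := ((V_step S q) ((runInv S q) ω m) hc hD).2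
  intro y hy
  refine (V_mono S q) ω (Nat.succ_le_of_lt hmn) ?_
  show y ∈ S.V ((hst S q) ω (m + 1))
  rw [h1]; exact Finset.mem_union_right _ hy

/-- The target of a probe is determined afterwards. [folklore] -/
theorem det_tgt_of_probe {m n : ℕ} (hmn : m < n) {e : Site 2 × MDir} (hc : ((schemeFK S q).stN m ω).choice = some e)
    (hD : (schemeFK S q).E.next ((hst S q) ω m) = some ((probeFK S q) ((hst S q) ω m) e)) : ((schemeFK S q).stN n ω).Det (tgt e) := by
  have hstN := ((step_some S q) hc hD).2.2
  refine (schemeFK S q).det_stN_mono ω (Nat.succ_le_of_lt hmn) ?_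
  rw [hstN]
  exact HState.det_update_tgt _ _ _

/-- **The explored region lies in the cover of the determined macro-vertices.**
[cite: KozmaNitzan2024, §4 pp. 26–27 ((29), (31))] -/
theorem V_subset_Cover (n : ℕ) : (↑(S.V ((hst S q) ω n)) : Set (Site d)) ⊆ S.C.Cover {x | ((schemeFK S q).stN n ω).Det x} := by
  intro y hy
  rcases ((runInv S q) ω n).V_cases y (Finset.mem_coe.1 hy) with h | ⟨m, hm, e, hc, -, hD, h⟩
  · exact S.C.subset_cover (u := 0) (Or.inl (zero_mem_occ n)) (Or.inl (Finset.mem_coe.2 (S.C.Q_subset_Cell _ h)))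
  · have hsrc : e.1 ∈ {x | ((schemeFK S q).stN n ω).Det x} :=
      Or.inl ((schemeFK S q).occ_stN_mono ω hm.le (HState.cand_of_choice hc).1)
    have htgt : tgt e ∈ {x | ((schemeFK S q).stN n ω).Det x} := det_tgt_of_probe hm hc hD
    rcases Finset.mem_union.1 h with h | h
    · rcases Finset.mem_union.1 (S.C.Ewv_subset_Cells _ _ h) with h | h
      · exact S.C.subset_cover hsrc (Or.inl (Finset.mem_coe.2 h))
      · exact S.C.subset_cover htgt (Or.inl (Finset.mem_coe.2 h))
    · obtain ⟨du, -, h⟩ := Finset.mem_biUnion.1 h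
      have hj : (jOfFK S q) ((hst S q) ω m) e du (obs ω (S.env ((hst S q) ω m) e)) + 1 ≤ S.C.K := (jOfFK_lt S q) _ _ _ _
      rcases Finset.mem_union.1 (S.C.Stub_subset_Cell_union_Zone _ _ hj h) with h | h
      · exact S.C.subset_cover htgt (Or.inl (Finset.mem_coe.2 h))
      · exact S.C.subset_cover htgt (Or.inr (Set.mem_iUnion.2 ⟨du, Finset.mem_coe.2 h⟩))

/-- **(29), converse half**: a macro-vertex whose centre is explored is determined. [cite: KozmaNitzan2024, §4 p. 26 ((29))] -/
theorem det_of_cen_mem_V {n : ℕ} {x : Site 2} (hx : S.C.cen x ∈ S.V ((hst S q) ω n)) : ((schemeFK S q).stN n ω).Det x :=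
  S.C.mem_of_cen_mem_Cover (V_subset_Cover n (Finset.mem_coe.2 hx))

/-- A probe's target is examined only once. [folklore] -/
theorem probe_time_unique {m m' : ℕ} {e e' : Site 2 × MDir} (hc : ((schemeFK S q).stN m ω).choice = some e)
    (hD : (schemeFK S q).E.next ((hst S q) ω m) = some ((probeFK S q) ((hst S q) ω m) e)) (hc' : ((schemeFK S q).stN m' ω).choice = some e')
    (hD' : (schemeFK S q).E.next ((hst S q) ω m') = some ((probeFK S q) ((hst S q) ω m') e')) (ht : tgt e' = tgt e) : m' = m := by
  by_contra hne
  rcases lt_or_gt_of_ne hne with hlt | hlt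
  · have h1 := det_tgt_of_probe hlt hc' hD'
    rw [ht] at h1
    exact (HState.cand_of_choice hc).2 h1
  · have h1 := det_tgt_of_probe hlt hc hD
    rw [← ht] at h1
    exact (HState.cand_of_choice hc').2 h1

/-! ## (31): nothing explored later meets `E_{w,v}` -/

/-- The new region of an examination along `e'` avoids `Btw(w, du) ∪ Q_v`, `v = w + du`, whenever the
target of `e'` is neither `w` nor `v` and its source is not `v`. [cite: KozmaNitzan2024, §4 p. 27 ((31))] -/
theorem newRegion_disjoint (h : ProbeHistory (Site d)) (e' : Site 2 × MDir) (o : Finset (Sym2 (Site d)))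
    {w : Site 2} {du : MDir} (hv' : tgt e' ≠ w + stepVec du) (hv'w : tgt e' ≠ w) (hw' : e'.1 ≠ w + stepVec du)
    {y : Site d} (hy : y ∈ (newRegionFK S q) h e' o) : y ∉ S.C.Btw w du ∧ y ∉ S.C.Q (w + stepVec du) := by
  have hQt : ∀ {z}, z ∈ S.C.Q (tgt e') → z ∉ S.C.Btw w du ∧ z ∉ S.C.Q (w + stepVec du) := fun hz =>
    ⟨Finset.disjoint_left.1 (S.C.Q_disjoint_Btw (tgt e') w du) hz, Finset.disjoint_left.1 (S.C.Q_disjoint_Q hv') hz⟩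
  rcases Finset.mem_union.1 hy with hy | hy
  · rcases Finset.mem_union.1 hy with hy | hy
    · refine ⟨fun hy' => ?_, Finset.disjoint_right.1 (S.C.Q_disjoint_Btw (w + stepVec du) e'.1 e'.2) hy⟩
      refine Finset.disjoint_left.1 (S.C.Btw_disjoint_Btw (v := w) (δ := du) (v' := e'.1) (δ' := e'.2) ?_ ?_) hy' hy
      · intro heq
        apply hv'
        have h1 : e'.1 = w := congrArg Prod.fst heq
        have h2 : e'.2 = du := congrArg Prod.snd heq
        show e'.1 + stepVec e'.2 = w + stepVec du
        rw [h1, h2]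
      · intro heq; exact hw' (congrArg Prod.fst heq)
    · exact hQt hy
  · obtain ⟨du'', -, hy⟩ := Finset.mem_biUnion.1 hy
    rcases Finset.mem_union.1 (S.C.Stub_subset_Q_union_Btw _ _ ((jOfFK_lt S q) _ _ _ _) hy) with hy | hy
    · exact hQt hy
    · refine ⟨fun hy' => ?_, Finset.disjoint_right.1 (S.C.Q_disjoint_Btw (w + stepVec du) (tgt e') du'') hy⟩
      refine Finset.disjoint_left.1 (S.C.Btw_disjoint_Btw (v := w) (δ := du) (v' := tgt e') (δ' := du'') ?_ ?_) hy' hy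
      · intro heq; exact hv'w (congrArg Prod.fst heq)
      · intro heq; exact hv' (congrArg Prod.fst heq)

/-- An undetermined neighbour is an onward direction of every earlier history. [cite: KozmaNitzan2024, §4 p. 27 (X = X_v)] -/
theorem mem_onward_of_not_det {m n : ℕ} (hmn : m ≤ n) {w : Site 2} {du : MDir}
    (hv : ¬((schemeFK S q).stN n ω).Det (w + stepVec du)) : du ∈ S.onward ((hst S q) ω m) w :=
  Finset.mem_filter.2 ⟨Finset.mem_univ _, fun h => hv ((schemeFK S q).det_stN_mono ω hmn (det_of_cen_mem_V h))⟩

/-- **(31)**: after the examination of `w` at time `m`, as long as `v = w + du` is undetermined, the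
explored region meets `E_{w,v}` only inside the stub `H^{j_x}_{w,v}` revealed at time `m`.
[cite: KozmaNitzan2024, §4 p. 27 ((31))] -/
theorem mem_Stub_of_mem_V_of_mem_Efar {n m : ℕ} (hm : m < n) {e : Site 2 × MDir}
    (hc : ((schemeFK S q).stN m ω).choice = some e) (hV : (ValidFK S q) ((hst S q) ω m) e)
    (hD : (schemeFK S q).E.next ((hst S q) ω m) = some ((probeFK S q) ((hst S q) ω m) e)) {du : MDir}
    (hv : ¬((schemeFK S q).stN n ω).Det (tgt e + stepVec du)) {y : Site d} (hyV : y ∈ S.V ((hst S q) ω n))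
    (hyE : y ∈ S.C.Efar (tgt e) du) :
    y ∈ S.C.Stub (tgt e) du ((jOfFK S q) ((hst S q) ω m) e du (obs ω (S.env ((hst S q) ω m) e))) := by
  have hdu : du ∈ S.onward ((hst S q) ω m) (tgt e) := mem_onward_of_not_det hm.le hv
  have hv0 : tgt e + stepVec du ≠ 0 := fun h => hv (by rw [h]; exact Or.inl (zero_mem_occ n))
  have hyE' := S.C.Efar_subset_Btw_union_Q _ _ hyE
  rcases ((runInv S q) ω n).V_cases y hyV with hy0 | ⟨m', hm', e', hc', hV', hD', hy'⟩
  · exfalso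
    rcases Finset.mem_union.1 hyE' with h | h
    · exact Finset.disjoint_left.1 (S.C.Q_disjoint_Btw 0 (tgt e) du) hy0 h
    · exact Finset.disjoint_left.1 (S.C.Q_disjoint_Q hv0.symm) hy0 h
  · by_cases hmm : m' = m
    · subst hmm
      rw [hc] at hc'
      cases Option.some_injective _ hc'
      rcases Finset.mem_union.1 hy' with hy' | hy'
      · exact absurd hyE (KSch.Valid.Ewv_not_mem_Efar (S := geomTwin S) (geomTwin_valid_of_validFK hV) hdu hy')
      · obtain ⟨du'', -, hy'⟩ := Finset.mem_biUnion.1 hy'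
        by_cases hdd : du'' = du
        · subst hdd; exact hy'
        · exfalso
          rcases Finset.mem_union.1 (S.C.Stub_subset_Q_union_Btw _ _ ((jOfFK_lt S q) _ _ _ _) hy') with h | h
          · exact S.C.Q_disjoint_Efar h hyE
          · exact (S.C.Btw_sep_Efar hdd).not_mem (Finset.mem_coe.2 h) (Finset.mem_coe.2 hyE)
    · exfalso
      have hv' : tgt e' ≠ tgt e + stepVec du := fun h => hv (h ▸ det_tgt_of_probe hm' hc' hD')
      have hv'w : tgt e' ≠ tgt e := fun h => hmm (probe_time_unique hc hD hc' hD' h)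
      have hw' : e'.1 ≠ tgt e + stepVec du := fun h =>
        hv (h ▸ Or.inl ((schemeFK S q).occ_stN_mono ω hm'.le (HState.cand_of_choice hc').1))
      obtain ⟨h1, h2⟩ := newRegion_disjoint _ _ _ hv' hv'w hw' hy'
      rcases Finset.mem_union.1 hyE' with h | h
      · exact h1 h
      · exact h2 h

/-- **(31) at the origin**: as long as `v = 0 + du` is undetermined, the explored region avoids
`E_{0,v}`. [cite: KozmaNitzan2024, §4 p. 28 ((E₁ ∪ E_{w,v}) ∩ E_i = E₁)] -/
theorem not_mem_Ewv_zero_of_mem_V {n : ℕ} {du : MDir} (hv : ¬((schemeFK S q).stN n ω).Det ((0 : Site 2) + stepVec du))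
    {y : Site d} (hyV : y ∈ S.V ((hst S q) ω n)) : y ∉ S.C.Ewv 0 du := by
  have hv0 : (0 : Site 2) + stepVec du ≠ 0 := fun h => hv (by rw [h]; exact Or.inl (zero_mem_occ n))
  intro hyE
  rcases ((runInv S q) ω n).V_cases y hyV with hy0 | ⟨m', hm', e', hc', -, hD', hy'⟩
  · rcases Finset.mem_union.1 hyE with h | h
    · exact Finset.disjoint_left.1 (S.C.Q_disjoint_Btw 0 0 du) hy0 h
    · exact Finset.disjoint_left.1 (S.C.Q_disjoint_Q hv0.symm) hy0 h
  · have hv' : tgt e' ≠ 0 + stepVec du := fun h => hv (h ▸ det_tgt_of_probe hm' hc' hD')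
    have hv'w : tgt e' ≠ 0 := fun h => (HState.cand_of_choice hc').2 (h ▸ Or.inl (zero_mem_occ m'))
    have hw' : e'.1 ≠ 0 + stepVec du := fun h =>
      hv (h ▸ Or.inl ((schemeFK S q).occ_stN_mono ω hm'.le (HState.cand_of_choice hc').1))
    obtain ⟨h1, h2⟩ := newRegion_disjoint _ _ _ hv' hv'w hw' hy'
    rcases Finset.mem_union.1 hyE with h | h
    · exact h1 h
    · exact h2 h

/-! ## (32) -/

end Consequences

end RunFK

end Summit.CriticalPhenomena.PercolationContinuityZ3.Theorems.FK

end
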